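import Literature.IUT.HodgeTheaters.TemperedCoveringsCor23viSurfaceTypeBranchGluing
import Literature.IUT.HodgeTheaters.TemperedCoveringsCor23viHatIncidenceTwoLevelSeparation
import HarnessLib

/-!
# [IUTchI] Cor. 2.3 (vi): the pro-`Σ̂` incidence `hF` at a DOUBLY-BOUND CUSP of a semi-graph of anabelioids of SURFACE
# TYPE — the «caveat» configuration — is a THEOREM (two-level separation by an `𝔽_ℓ²`-translation covering)

S. Mochizuki, *Inter-universal Teichmüller theory I*, kurims manuscript (May 2020), §2, Cor. 2.3 (vi) p. 48 l. 6–16, proof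
p. 49 l. 62–64 («by passing to pro-`Σ` completions») [cite: Mochizuki2012, Cor 2.3(vi) pp.48-49] (D-0012 claim key; series
DISPUTED; nothing of the series is asserted here); S. Mochizuki, *Semi-graphs of anabelioids*, Publ. RIMS **42** (2006),
Example 2.10 p. 31 (semi-graphs of anabelioids of pointed stable curves: «each `Π_v` is the maximal pro-`Σ` quotient of
the fundamental group of a hyperbolic Riemann surface of finite type … each `Π_b → Π_v` is the inclusion morphism of the
inertia group of one of the cusps»), §3 Def. 3.5 (i)/(ii) p. 37, Prop. 3.6 (iii) p. 38 [cite: MochizukiSemiAnbd2006, Ex. 2.10 p.31].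

PROOF-ONLY file (abc-iut cell, seat abc-iut-L5-d5 gen 10, self-named count-neutral in-lineage row
«COR23VI-HF-TWO-LEVEL@CAVEAT», part (2e) = the assembly; cone row `IUTchI:Cor2.3(vi)` (discharged, RULINGS #118);
GAP-LEDGER G-w4d059-g8-1; no definition, no instance, no notation, no `Prop` fact).  Consumed BY NAME: this lineage's
two-level criterion (p507622: `exists_twoLevel_decomp_singleVertex_of_coverings`, `not_map_le_conj_closure_of_twoLevel`),
the translation-covering constructor (`TranslationCover.exists_cover`), the surface-type character lemmas
(`exists_character_cusp_eq`, `branch_values`, `glue_of_data`, `glue₁_of_data`), abc-iut-L3-t2's `FiniteIsTempered_holds`.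

WHAT WAS OPEN.  The residual binder `hF` of row `IUTchI:Cor2.3(vi)` («pro-`Σ̂` edge–subgraph incidence», GAP-LEDGER
G-w4d059-g8-1) was known (p498282/p503058, abc-iut-w4-d070's census D-G-w4d059-g8-1 of 2026-08-27T06:03:58Z) to resist the
one-level «killing» criterion exactly at the CAVEAT configurations: an edge with an end at a vertex `u ∉ ℍ` all of whose
other branches run into `ℍ`, where `Π_e ≤ ncl(Π^tp_ℍ)`; the routes then on record were profinite Bass–Serre (route A)
or subgroup-into-conjugacy separability (route B3), both FACT-class.  THIS FILE proves `hF`'s content at every such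
cusp for `ℍ` a single vertex, for EVERY semi-graph of profinite groups carrying abc-iut-L3's surface-type datum:

**`DoublyBoundCusp.not_map_le_conj_closure_of_doublyBound`** — let `𝒢 : ProfiniteSemiGraph` satisfy the hypotheses of
[SemiAnbd] Prop. 3.6 and carry the surface-type datum `hv` of `ProfiniteSemiGraph.isOfSurfaceType_toAnab` (at every
vertex a pro-`Σ` completion `ι_v : Γ_{g_v,r_v} → Π_v`, an injective cusp assignment `js_v`, branch groups the conjugated
closed cusp inertia groups); let `ℓ ∈ Σ` be prime, `u ≠ w` vertices, `e` a CUSP at `u` (its other branch abuts no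
vertex) and `b₁ ≠ b₂` two further branches at `u` whose edges have branches `b₁', b₂'` at `w`.  Then for EVERY chart
`c` of `π₁^temp(𝒢)`, EVERY profinite completion `ι`, EVERY `Π^tp_ℍ := TpH ∈ decompSubgroups c ⟨{w}, ∅⟩`, EVERY edge-like
`L` at `e` and EVERY `g ∈ Π̂`:  `ι(L) ⊄ g · closure ι(Π^tp_ℍ) · g⁻¹` — the premise of `hF` FAILS at `e` (its conclusion
being false there: `e` abuts `u ∉ ℍ` only).  This covers every caveat cusp at a single-vertex `ℍ` (a genus-`0` vertex
all of whose other branches are bound to `w` has `≥ 2` of them) — with NO genus or «caveat» hypothesis at all.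

CONSTRUCTION (all local, no profinite trees): cusp characters `χ_u : Π_u → 𝔽_ℓ²` with `c_{j₁} ↦ (1,1)`,
`c_{j₂} ↦ (−1,0)`, `c_{j_e} ↦ (0,−1)`, other generators `↦ 0`, and `χ_w : Π_w → 𝔽_ℓ × 0` with `c_{j₁'} ↦ (1,0)`,
`c_{j₂'} ↦ (−1,0)`; all other vertices trivial.  The TRANSLATION COVERING `S₂` of `𝒢` with fibre `𝔽_ℓ²` (gluing along
`f₁ = [b₁, b₁']` by a shear composed with a unit, along `f₂` by a unit — the edge groups being topologically cyclic with
a UNIQUE closed subgroup of index `ℓ`; identity elsewhere) and its first-coordinate image `S₁` (fibre `ℤ/ℓ`) satisfy: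
(a) an element of `Π_w` fixing `S₁,w` fixes `S₂,w` (`χ_w` lives on the first axis); (b) the conjugated cusp generator of
`Π_e` fixes `S₁,e` (value `0`) and MOVES `S₂,e` (value `(0,−1)`).  Hence, by p507622, `N := Ker c(S₁)`, `U := Ker c(S₂)`
separate at two levels and `hF`'s premise is refuted in the completion (monodromy of `S₂` inside `𝔽_ℓ ≀ 𝔽_ℓ`).

## BINDER CENSUS TABLE (L5-lead RULINGS #101 (2) format)

| binder | class | what it is |
|---|---|---|
| `h36 : 𝒢.Prop36Hypotheses` | DATA (hypotheses of [SemiAnbd] Prop. 3.6; at the genuine datum `S.hyp.toProp36Hypotheses`) | chart dictionary / finite ⇒ tempered |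
| `hv` (surface-type datum, all vertices) | ORIGIN at the genuine `S.Gc` (abstract `Thm37Hypotheses` data); THEOREM-class for abc-iut-L3's decorated stable-graph models (`SurfaceTypeStableGraphModels`) | [SemiAnbd] Ex. 2.10 structure |
| `ℓ`, `hℓS : ℓ ∈ Σ` | DATA | a prime of `Σ` (non-empty) |
| `u ≠ w`, `be b₁ b₂ : Star u`, `b₁ ≠ b₂`, `hopen`, `b₁' b₂' : Star w`, `hf₁ hf₂` | DATA (the configuration) | cusp at `u`, double bond `u = w` |
| `c`, `ι`, `hι`, `TpH`, `hTpH`, `L`, `hL`, `g` | DATA (any) | the quantifiers of `hF` |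

COUNTS: LAW 0 · FACT 0 · ORIGIN 1 (`hv`, only at the genuine datum).  HONEST LIMITS: (i) single-vertex `ℍ = ⟨{w}, ∅⟩`
(the tree's decomposition-subgroup dictionary exists for single vertices only); (ii) `e` a cusp (closed caveat edges need a
second pinched end — same method, not here); (iii) non-vacuity of the hypothesis class is abc-iut-L3's decorated
stable-graph models + the §2/§3 presentation bridges, not assembled here; (iv) at the genuine `S.Gc` the datum `hv` is an
ORIGIN reading ([SemiAnbd] Ex. 3.10 / 2.10), so G-w4d059-g8-1 is NOT discharged at the genuine datum by this file.
Nothing here bears on [IUTchIII] Cor. 3.12; typed ≠ inhabited ≠ discharged; nothing asserts that abc is proved or refuted.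
-/

noncomputable section

namespace Literature.IUT.HodgeTheaters

open _root_.Topology CategoryTheory
open scoped Pointwise
open Literature.AnabelianGeometry.SemiGraphs
open Literature.AnabelianGeometry.SemiGraphs.ProfiniteSemiGraph
open Literature.AnabelianGeometry.SemiGraphs.SemiGraphOfAnabelioids (IsProSigmaCompletion)
open Literature.GroupTheory.CombinatorialGroupTheory
open Literature.GroupTheory.CombinatorialGroupTheory.PuncturedSurfaceGroup
open Multiplicative SurfaceTypeCharacters TranslationCover

namespace DoublyBoundCusp

variable {𝒢 : ProfiniteSemiGraph.{0}}

section Main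

variable {ℓ : ℕ} [hℓ : Fact ℓ.Prime]

/-- **[IUTchI] Cor. 2.3 (vi): the premise of the pro-`Σ̂` incidence `hF` FAILS at every cusp of a doubly-bound vertex of a
semi-graph of anabelioids of surface type** (so `hF` holds there although no finite quotient killing `Π^tp_ℍ` separates —
the caveat configuration of GAP-LEDGER G-w4d059-g8-1).  For `𝒢` with the hypotheses of [SemiAnbd] Prop. 3.6 and the
surface-type datum of Example 2.10 at every vertex, a prime `ℓ ∈ Σ`, vertices `u ≠ w`, a cusp `e = edgeOf be` at `u`
(`hopen`: its other branch abuts no vertex), two further branches `b₁ ≠ b₂` at `u` whose edges carry branches `b₁', b₂'`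
at `w`: for every chart, every profinite completion `ι`, every `TpH ∈ decompSubgroups c ⟨{w}, ∅⟩`, every edge-like `L`
at `e` and every `g`, `ι(L) ⊄ g · closure ι(TpH) · g⁻¹`.  Proof: the `𝔽_ℓ²`-translation covering and its first
coordinate give a two-level separation (p507622). [cite: Mochizuki2012, Cor 2.3(vi) pp.48-49]
[cite: MochizukiSemiAnbd2006, Ex. 2.10 p.31] [claim: Mochizuki2012, status: disputed] -/
theorem not_map_le_conj_closure_of_doublyBound (h36 : 𝒢.Prop36Hypotheses) {Sigma : Set ℕ} (hℓS : ℓ ∈ Sigma)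
    (hv : ∀ v : 𝒢.graph.Vertex, ∃ (g r : ℕ) (ι : PuncturedSurfaceGroup g r →* 𝒢.Gv v),
      IsHyperbolicType g r ∧ IsProSigmaCompletion Sigma ι ∧
        ∃ js : 𝒢.graph.Star v → Fin r, Function.Injective js ∧
          ∀ b : 𝒢.graph.Star v, ∃ x : 𝒢.Gv v, 𝒢.branchSubgroup b.1 v b.2 =
            ConjAct.toConjAct x • ((cuspInertia (g := g) (js b)).map ι).topologicalClosure)
    {u w : 𝒢.graph.Vertex} (huw : u ≠ w) (be b₁ b₂ : 𝒢.graph.Star u) (h₁₂ : b₁ ≠ b₂)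
    (hopen : ∀ b' : 𝒢.graph.Branch, 𝒢.graph.edgeOf b' = 𝒢.graph.edgeOf be.1 → b' ≠ be.1 → 𝒢.graph.abuts b' = none)
    (b₁' b₂' : 𝒢.graph.Star w) (hf₁ : 𝒢.graph.edgeOf b₁'.1 = 𝒢.graph.edgeOf b₁.1)
    (hf₂ : 𝒢.graph.edgeOf b₂'.1 = 𝒢.graph.edgeOf b₂.1)
    (c : TemperedPiChart 𝒢) {Ghat : Type*} [Group Ghat] [TopologicalSpace Ghat] [IsTopologicalGroup Ghat]
    {ι : c.G →ₜ* Ghat} (hι : IsProfiniteCompletion ι) {TpH : Subgroup c.G}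
    (hTpH : TpH ∈ c.decompSubgroups ⟨{w}, ∅⟩) {L : Subgroup c.G}
    (hL : L ∈ edgeLikeSubgroups c (𝒢.graph.edgeOf be.1)) (g : Ghat) :
    ¬ L.map ι.toMonoidHom ≤ MulAut.conj g • (TpH.map ι.toMonoidHom).topologicalClosure := by
  classical
  haveI : Fact ℓ.Prime := hℓ
  /- 0. combinatorics of the five branches -/
  have hst : ∀ (x : 𝒢.graph.Star u) (y : 𝒢.graph.Star w), y.1 ≠ x.1 := fun x y h =>
    huw (Option.some.inj (x.2.symm.trans (h ▸ y.2)))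
  have hbe₁ : b₁ ≠ be := by
    rintro rfl
    exact absurd (hopen b₁'.1 hf₁ (hst b₁ b₁')) (by rw [b₁'.2]; exact Option.some_ne_none w)
  have hbe₂ : b₂ ≠ be := by
    rintro rfl
    exact absurd (hopen b₂'.1 hf₂ (hst b₂ b₂')) (by rw [b₂'.2]; exact Option.some_ne_none w)
  have h₁₂' : b₁' ≠ b₂' := by
    intro h
    have he : 𝒢.graph.edgeOf b₂.1 = 𝒢.graph.edgeOf b₁.1 := hf₂.symm.trans (h ▸ hf₁)
    rcases eq_or_eq_of_edgeOf_eq (hst b₁ b₁').symm hf₁ he with h' | h'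
    · exact h₁₂ (Subtype.ext h').symm
    · exact hst b₂ b₁' h'.symm
  /- 1. surface data at `u` and `w`; the characters -/
  obtain ⟨gu, ru, ιu, -, hιu, jsu, hjsu, hbru⟩ := hv u
  obtain ⟨gw, rw, ιw, -, hιw, jsw, hjsw, hbrw⟩ := hv w
  let du : Fin ru → ZMod ℓ × ZMod ℓ :=
    Pi.single (jsu b₁) (1, 1) + Pi.single (jsu b₂) (-1, 0) + Pi.single (jsu be) (0, -1)
  have hdu_sum : ∑ j, du j = 0 := by
    simp only [du, Pi.add_apply, Finset.sum_add_distrib, Finset.sum_pi_single', Finset.mem_univ, if_true]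
    ext <;> simp
  have hdu₁ : du (jsu b₁) = (1, 1) := by
    simp only [du, Pi.add_apply, Pi.single_eq_same, Pi.single_eq_of_ne (hjsu.ne h₁₂), 
      Pi.single_eq_of_ne (hjsu.ne hbe₁), add_zero]
  have hdu₂ : du (jsu b₂) = (-1, 0) := by
    simp only [du, Pi.add_apply, Pi.single_eq_same, Pi.single_eq_of_ne (hjsu.ne h₁₂.symm),
      Pi.single_eq_of_ne (hjsu.ne hbe₂), zero_add, add_zero]
  have hdue : du (jsu be) = (0, -1) := by
    simp only [du, Pi.add_apply, Pi.single_eq_same, Pi.single_eq_of_ne (hjsu.ne hbe₁.symm),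
      Pi.single_eq_of_ne (hjsu.ne hbe₂.symm), zero_add]
  have hdu0 : ∀ b : 𝒢.graph.Star u, b ≠ b₁ → b ≠ b₂ → b ≠ be → du (jsu b) = 0 := fun b h1 h2 h3 => by
    simp only [du, Pi.add_apply, Pi.single_eq_of_ne (hjsu.ne h1), Pi.single_eq_of_ne (hjsu.ne h2),
      Pi.single_eq_of_ne (hjsu.ne h3), add_zero]
  have hcardu : Nat.card (ZMod ℓ × ZMod ℓ) = ℓ ^ 2 := by rw [Nat.card_prod, Nat.card_zmod, pow_two]
  obtain ⟨χu, hχuo, hχu⟩ := exists_character_cusp_eq (g := gu) hιu hℓ.out hℓS hcardu du hdu_sum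
  let dw : Fin rw → ZMod ℓ := Pi.single (jsw b₁') 1 + Pi.single (jsw b₂') (-1)
  have hdw_sum : ∑ j, dw j = 0 := by
    simp only [dw, Pi.add_apply, Finset.sum_add_distrib, Finset.sum_pi_single', Finset.mem_univ, if_true,
      add_neg_cancel]
  have hdw₁ : dw (jsw b₁') = 1 := by
    simp only [dw, Pi.add_apply, Pi.single_eq_same, Pi.single_eq_of_ne (hjsw.ne h₁₂'), add_zero]
  have hdw₂ : dw (jsw b₂') = -1 := by
    simp only [dw, Pi.add_apply, Pi.single_eq_same, Pi.single_eq_of_ne (hjsw.ne h₁₂'.symm), zero_add]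
  have hdw0 : ∀ b : 𝒢.graph.Star w, b ≠ b₁' → b ≠ b₂' → dw (jsw b) = 0 := fun b h1 h2 => by
    simp only [dw, Pi.add_apply, Pi.single_eq_of_ne (hjsw.ne h1), Pi.single_eq_of_ne (hjsw.ne h2), add_zero]
  have hcardw : Nat.card (ZMod ℓ) = ℓ ^ 1 := by rw [Nat.card_zmod, pow_one]
  obtain ⟨χw, hχwo, hχw⟩ := exists_character_cusp_eq (g := gw) hιw hℓ.out hℓS hcardw dw hdw_sum
  -- continuous versions; `χ_w` pushed into the first axis of `𝔽_ℓ²`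
  let inl : Multiplicative (ZMod ℓ) →ₜ* Multiplicative (ZMod ℓ × ZMod ℓ) :=
    ⟨(AddMonoidHom.inl (ZMod ℓ) (ZMod ℓ)).toMultiplicative, continuous_of_discreteTopology⟩
  let fst : Multiplicative (ZMod ℓ × ZMod ℓ) →ₜ* Multiplicative (ZMod ℓ) :=
    ⟨(AddMonoidHom.fst (ZMod ℓ) (ZMod ℓ)).toMultiplicative, continuous_of_discreteTopology⟩
  let χu' : 𝒢.Gv u →ₜ* Multiplicative (ZMod ℓ × ZMod ℓ) := ⟨χu, continuous_of_isOpen_ker χu hχuo⟩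
  let χw₁ : 𝒢.Gv w →ₜ* Multiplicative (ZMod ℓ) := ⟨χw, continuous_of_isOpen_ker χw hχwo⟩
  let dw₂ : Fin rw → ZMod ℓ × ZMod ℓ := fun j => (dw j, 0)
  have hχw₂ : ∀ j, inl.comp χw₁ (ιw (PuncturedSurfaceGroup.c j)) = ofAdd (dw₂ j) := fun j => by
    change inl (χw (ιw (PuncturedSurfaceGroup.c j))) = _
    rw [hχw]
    rfl
  let χ₂ : ∀ v : 𝒢.graph.Vertex, 𝒢.Gv v →ₜ* Multiplicative (ZMod ℓ × ZMod ℓ) := fun v =>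
    if h : v = u then h ▸ χu' else if h' : v = w then h' ▸ inl.comp χw₁ else 1
  have hχ₂u : χ₂ u = χu' := by
    change (if h : u = u then h ▸ χu' else if h' : u = w then h' ▸ inl.comp χw₁ else 1) = χu'
    rw [dif_pos rfl]
  have hχ₂w : χ₂ w = inl.comp χw₁ := by
    change (if h : w = u then h ▸ χu' else if h' : w = w then h' ▸ inl.comp χw₁ else 1) = inl.comp χw₁
    rw [dif_neg (Ne.symm huw), dif_pos rfl]
  have hχ₂o : ∀ v, v ≠ u → v ≠ w → χ₂ v = 1 := fun v h h' => by
    change (if h : v = u then h ▸ χu' else if h' : v = w then h' ▸ inl.comp χw₁ else 1) = 1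
    rw [dif_neg h, dif_neg h']
  let χ₁ : ∀ v : 𝒢.graph.Vertex, 𝒢.Gv v →ₜ* Multiplicative (ZMod ℓ) := fun v => fst.comp (χ₂ v)
  /- 2. values on the branch groups -/
  have hVu := branch_values h36.isOfInjectiveType ιu jsu hbru χu' du hχu
  have hVw := branch_values h36.isOfInjectiveType ιw jsw hbrw (inl.comp χw₁) dw₂ hχw₂
  have hdw₂₁ : dw₂ (jsw b₁') = (1, 0) := by change (dw (jsw b₁'), (0 : ZMod ℓ)) = _; rw [hdw₁]
  have hdw₂₂ : dw₂ (jsw b₂') = (-1, 0) := by change (dw (jsw b₂'), (0 : ZMod ℓ)) = _; rw [hdw₂]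
  have hd11 : ((1, 1) : ZMod ℓ × ZMod ℓ) ≠ 0 := fun h => one_ne_zero (Prod.mk_eq_zero.mp h).1
  have hd10 : ((1, 0) : ZMod ℓ × ZMod ℓ) ≠ 0 := fun h => one_ne_zero (Prod.mk_eq_zero.mp h).1
  have hdm10 : ((-1, 0) : ZMod ℓ × ZMod ℓ) ≠ 0 := fun h => neg_ne_zero.mpr one_ne_zero (Prod.mk_eq_zero.mp h).1
  /- 3. the partner structure of the five branches -/
  have hP : ∀ (b : 𝒢.graph.Branch) (v : 𝒢.graph.Vertex) (hb : 𝒢.graph.abuts b = some v) (b' : 𝒢.graph.Branch)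
      (v' : 𝒢.graph.Vertex) (hb' : 𝒢.graph.abuts b' = some v'), 𝒢.graph.edgeOf b' = 𝒢.graph.edgeOf b → b' ≠ b →
      b ≠ be.1 ∧ (b = b₁.1 → b' = b₁'.1) ∧ (b = b₁'.1 → b' = b₁.1) ∧ (b = b₂.1 → b' = b₂'.1) ∧
        (b = b₂'.1 → b' = b₂.1) := by
    intro b v hb b' v' hb' he hne
    refine ⟨fun h => ?_, fun h => ?_, fun h => ?_, fun h => ?_, fun h => ?_⟩
    · subst h
      exact absurd (hopen b' he hne) (by rw [hb']; exact Option.some_ne_none v')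
    · subst h
      exact (eq_or_eq_of_edgeOf_eq (hst b₁ b₁').symm hf₁ he).resolve_left hne
    · subst h
      exact (eq_or_eq_of_edgeOf_eq (hst b₁ b₁') hf₁.symm he).resolve_left hne
    · subst h
      exact (eq_or_eq_of_edgeOf_eq (hst b₂ b₂').symm hf₂ he).resolve_left hne
    · subst h
      exact (eq_or_eq_of_edgeOf_eq (hst b₂ b₂') hf₂.symm he).resolve_left hne
  /- 4. off the five branches every character is trivial on the branch group -/
  have hT : ∀ (b : 𝒢.graph.Branch) (v : 𝒢.graph.Vertex) (hb : 𝒢.graph.abuts b = some v),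
      b ≠ b₁.1 → b ≠ b₁'.1 → b ≠ b₂.1 → b ≠ b₂'.1 → b ≠ be.1 → ∀ t, χ₂ v (𝒢.brHom b v hb t) = 1 := by
    intro b v hb n1 n1' n2 n2' ne t
    by_cases hvu : v = u
    · subst hvu
      have h0 := hdu0 ⟨b, hb⟩ (fun h => n1 (congrArg Subtype.val h)) (fun h => n2 (congrArg Subtype.val h))
        (fun h => ne (congrArg Subtype.val h))
      have h := (hVu ⟨b, hb⟩).1 t
      rw [h0, AddSubgroup.zmultiples_zero_eq_bot, AddSubgroup.mem_bot] at h
      rw [hχ₂u, ← ofAdd_toAdd (χu' _), h, ofAdd_zero]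
    · by_cases hvw : v = w
      · subst hvw
        have h0 : dw₂ (jsw ⟨b, hb⟩) = 0 := by
          change (dw (jsw ⟨b, hb⟩), (0 : ZMod ℓ)) = 0
          rw [hdw0 ⟨b, hb⟩ (fun h => n1' (congrArg Subtype.val h)) (fun h => n2' (congrArg Subtype.val h))]
          rfl
        have h := (hVw ⟨b, hb⟩).1 t
        rw [h0, AddSubgroup.zmultiples_zero_eq_bot, AddSubgroup.mem_bot] at h
        rw [hχ₂w, ← ofAdd_toAdd (inl.comp χw₁ _), h, ofAdd_zero]
      · rw [hχ₂o v hvu hvw]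
        rfl
  /- 5. gluing data for the plane covering `S₂` -/
  have hglue₂ : ∀ (b : 𝒢.graph.Branch) (v : 𝒢.graph.Vertex) (hb : 𝒢.graph.abuts b = some v)
      (b' : 𝒢.graph.Branch) (v' : 𝒢.graph.Vertex) (hb' : 𝒢.graph.abuts b' = some v')
      (he : 𝒢.graph.edgeOf b' = 𝒢.graph.edgeOf b), b' ≠ b →
      ∃ A : Multiplicative (ZMod ℓ × ZMod ℓ) ≃ Multiplicative (ZMod ℓ × ZMod ℓ),
        ∀ (t : 𝒢.Ge (𝒢.graph.edgeOf b)) (m : Multiplicative (ZMod ℓ × ZMod ℓ)),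
          A ((he ▸ (χ₂ v').comp (𝒢.brHom b' v' hb') : 𝒢.Ge (𝒢.graph.edgeOf b) →ₜ* _) t * m) =
            χ₂ v (𝒢.brHom b v hb t) * A m := by
    intro b v hb b' v' hb' he hne
    obtain ⟨hnbe, hp₁, hp₁', hp₂, hp₂'⟩ := hP b v hb b' v' hb' he hne
    obtain ⟨hnbe', hq₁, hq₁', hq₂, hq₂'⟩ := hP b' v' hb' b v hb he.symm hne.symm
    -- values at the four special branches, in `χ₂`-currency
    have hU : ∀ x : 𝒢.graph.Star u, (∀ t, toAdd (χ₂ u (𝒢.brHom x.1 u x.2 t)) ∈ AddSubgroup.zmultiples (du (jsu x)))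
        ∧ ((du (jsu x) ≠ 0) → ∃ t, χ₂ u (𝒢.brHom x.1 u x.2 t) ≠ 1) := fun x => by
      refine ⟨fun t => by rw [hχ₂u]; exact (hVu x).1 t, fun hx => ?_⟩
      obtain ⟨t, ht⟩ := (hVu x).2.1
      exact ⟨t, by rw [hχ₂u, ht]; exact fun h => hx (ofAdd_eq_one.mp h)⟩
    have hW : ∀ x : 𝒢.graph.Star w, (∀ t, toAdd (χ₂ w (𝒢.brHom x.1 w x.2 t)) ∈ AddSubgroup.zmultiples (dw₂ (jsw x)))
        ∧ ((dw₂ (jsw x) ≠ 0) → ∃ t, χ₂ w (𝒢.brHom x.1 w x.2 t) ≠ 1) := fun x => by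
      refine ⟨fun t => by rw [hχ₂w]; exact (hVw x).1 t, fun hx => ?_⟩
      obtain ⟨t, ht⟩ := (hVw x).2.1
      exact ⟨t, by rw [hχ₂w, ht]; exact fun h => hx (ofAdd_eq_one.mp h)⟩
    by_cases e1 : b = b₁.1
    · subst e1
      obtain rfl : v = u := Option.some.inj (hb.symm.trans b₁.2)
      obtain rfl : b' = b₁'.1 := hp₁ rfl
      obtain rfl : v' = w := Option.some.inj (hb'.symm.trans b₁'.2)
      obtain ⟨z₀, hz⟩ := (hVu b₁).2.2
      exact glue_of_data χ₂ hb hb' he hz (hdu₁ ▸ hd11) (hdw₂₁ ▸ hd10) (hU b₁).1 (hW b₁').1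
        ((hU b₁).2 (hdu₁ ▸ hd11)) ((hW b₁').2 (hdw₂₁ ▸ hd10))
    by_cases e1' : b = b₁'.1
    · subst e1'
      obtain rfl : v = w := Option.some.inj (hb.symm.trans b₁'.2)
      obtain rfl : b' = b₁.1 := hp₁' rfl
      obtain rfl : v' = u := Option.some.inj (hb'.symm.trans b₁.2)
      obtain ⟨z₀, hz⟩ := (hVw b₁').2.2
      exact glue_of_data χ₂ hb hb' he hz (hdw₂₁ ▸ hd10) (hdu₁ ▸ hd11) (hW b₁').1 (hU b₁).1
        ((hW b₁').2 (hdw₂₁ ▸ hd10)) ((hU b₁).2 (hdu₁ ▸ hd11))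
    by_cases e2 : b = b₂.1
    · subst e2
      obtain rfl : v = u := Option.some.inj (hb.symm.trans b₂.2)
      obtain rfl : b' = b₂'.1 := hp₂ rfl
      obtain rfl : v' = w := Option.some.inj (hb'.symm.trans b₂'.2)
      obtain ⟨z₀, hz⟩ := (hVu b₂).2.2
      exact glue_of_data χ₂ hb hb' he hz (hdu₂ ▸ hdm10) (hdw₂₂ ▸ hdm10) (hU b₂).1 (hW b₂').1
        ((hU b₂).2 (hdu₂ ▸ hdm10)) ((hW b₂').2 (hdw₂₂ ▸ hdm10))
    by_cases e2' : b = b₂'.1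
    · subst e2'
      obtain rfl : v = w := Option.some.inj (hb.symm.trans b₂'.2)
      obtain rfl : b' = b₂.1 := hp₂' rfl
      obtain rfl : v' = u := Option.some.inj (hb'.symm.trans b₂.2)
      obtain ⟨z₀, hz⟩ := (hVw b₂').2.2
      exact glue_of_data χ₂ hb hb' he hz (hdw₂₂ ▸ hdm10) (hdu₂ ▸ hdm10) (hW b₂').1 (hU b₂).1
        ((hW b₂').2 (hdw₂₂ ▸ hdm10)) ((hU b₂).2 (hdu₂ ▸ hdm10))
    -- off the special branches: both characters are trivial
    have h1 : ∀ t, χ₂ v (𝒢.brHom b v hb t) = 1 := hT b v hb e1 e1' e2 e2' hnbe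
    have h2 : ∀ t', χ₂ v' (𝒢.brHom b' v' hb' t') = 1 :=
      hT b' v' hb' (fun h => e1' (hq₁ h)) (fun h => e1 (hq₁' h)) (fun h => e2' (hq₂ h)) (fun h => e2 (hq₂' h)) hnbe'
    refine ⟨Equiv.refl _, fun t m => ?_⟩
    rw [Equiv.refl_apply, Equiv.refl_apply, h1 t, forall_transport χ₂ hb' he (P := fun m => m = 1) h2 t]
  /- 5'. gluing data for the line covering `S₁` (first coordinate) -/
  have hglue₁ : ∀ (b : 𝒢.graph.Branch) (v : 𝒢.graph.Vertex) (hb : 𝒢.graph.abuts b = some v)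
      (b' : 𝒢.graph.Branch) (v' : 𝒢.graph.Vertex) (hb' : 𝒢.graph.abuts b' = some v')
      (he : 𝒢.graph.edgeOf b' = 𝒢.graph.edgeOf b), b' ≠ b →
      ∃ A : Multiplicative (ZMod ℓ) ≃ Multiplicative (ZMod ℓ),
        ∀ (t : 𝒢.Ge (𝒢.graph.edgeOf b)) (m : Multiplicative (ZMod ℓ)),
          A ((he ▸ (χ₁ v').comp (𝒢.brHom b' v' hb') : 𝒢.Ge (𝒢.graph.edgeOf b) →ₜ* _) t * m) =
            χ₁ v (𝒢.brHom b v hb t) * A m := by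
    intro b v hb b' v' hb' he hne
    obtain ⟨hnbe, hp₁, hp₁', hp₂, hp₂'⟩ := hP b v hb b' v' hb' he hne
    obtain ⟨hnbe', hq₁, hq₁', hq₂, hq₂'⟩ := hP b' v' hb' b v hb he.symm hne.symm
    -- non-triviality of the first coordinate at the four special branches
    have hU : ∀ x : 𝒢.graph.Star u, (du (jsu x)).1 ≠ 0 → ∃ t, χ₁ u (𝒢.brHom x.1 u x.2 t) ≠ 1 := fun x hx => by
      obtain ⟨t, ht⟩ := (hVu x).2.1
      refine ⟨t, fun h => hx ?_⟩
      have h' : fst (χ₂ u (𝒢.brHom x.1 u x.2 t)) = 1 := h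
      rw [hχ₂u, ht] at h'
      exact ofAdd_eq_one.mp h'
    have hW : ∀ x : 𝒢.graph.Star w, (dw₂ (jsw x)).1 ≠ 0 → ∃ t, χ₁ w (𝒢.brHom x.1 w x.2 t) ≠ 1 := fun x hx => by
      obtain ⟨t, ht⟩ := (hVw x).2.1
      refine ⟨t, fun h => hx ?_⟩
      have h' : fst (χ₂ w (𝒢.brHom x.1 w x.2 t)) = 1 := h
      rw [hχ₂w, ht] at h'
      exact ofAdd_eq_one.mp h'
    have h1ne : (1 : ZMod ℓ) ≠ 0 := one_ne_zero
    have hm1ne : (-1 : ZMod ℓ) ≠ 0 := neg_ne_zero.mpr one_ne_zero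
    by_cases e1 : b = b₁.1
    · subst e1
      obtain rfl : v = u := Option.some.inj (hb.symm.trans b₁.2)
      obtain rfl : b' = b₁'.1 := hp₁ rfl
      obtain rfl : v' = w := Option.some.inj (hb'.symm.trans b₁'.2)
      obtain ⟨z₀, hz⟩ := (hVu b₁).2.2
      exact glue₁_of_data χ₁ hb hb' he hz (hU b₁ (by rw [hdu₁]; exact h1ne)) (hW b₁' (by rw [hdw₂₁]; exact h1ne))
    by_cases e1' : b = b₁'.1
    · subst e1'
      obtain rfl : v = w := Option.some.inj (hb.symm.trans b₁'.2)
      obtain rfl : b' = b₁.1 := hp₁' rfl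
      obtain rfl : v' = u := Option.some.inj (hb'.symm.trans b₁.2)
      obtain ⟨z₀, hz⟩ := (hVw b₁').2.2
      exact glue₁_of_data χ₁ hb hb' he hz (hW b₁' (by rw [hdw₂₁]; exact h1ne)) (hU b₁ (by rw [hdu₁]; exact h1ne))
    by_cases e2 : b = b₂.1
    · subst e2
      obtain rfl : v = u := Option.some.inj (hb.symm.trans b₂.2)
      obtain rfl : b' = b₂'.1 := hp₂ rfl
      obtain rfl : v' = w := Option.some.inj (hb'.symm.trans b₂'.2)
      obtain ⟨z₀, hz⟩ := (hVu b₂).2.2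
      exact glue₁_of_data χ₁ hb hb' he hz (hU b₂ (by rw [hdu₂]; exact hm1ne)) (hW b₂' (by rw [hdw₂₂]; exact hm1ne))
    by_cases e2' : b = b₂'.1
    · subst e2'
      obtain rfl : v = w := Option.some.inj (hb.symm.trans b₂'.2)
      obtain rfl : b' = b₂.1 := hp₂' rfl
      obtain rfl : v' = u := Option.some.inj (hb'.symm.trans b₂.2)
      obtain ⟨z₀, hz⟩ := (hVw b₂').2.2
      exact glue₁_of_data χ₁ hb hb' he hz (hW b₂' (by rw [hdw₂₂]; exact hm1ne)) (hU b₂ (by rw [hdu₂]; exact hm1ne))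
    have h1 : ∀ t, χ₁ v (𝒢.brHom b v hb t) = 1 := fun t => by
      change fst (χ₂ v (𝒢.brHom b v hb t)) = 1
      rw [hT b v hb e1 e1' e2 e2' hnbe t, map_one]
    have h2 : ∀ t', χ₁ v' (𝒢.brHom b' v' hb' t') = 1 := fun t' => by
      change fst (χ₂ v' (𝒢.brHom b' v' hb' t')) = 1
      rw [hT b' v' hb' (fun h => e1' (hq₁ h)) (fun h => e1 (hq₁' h)) (fun h => e2' (hq₂ h))
        (fun h => e2 (hq₂' h)) hnbe' t', map_one]
    refine ⟨Equiv.refl _, fun t m => ?_⟩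
    rw [Equiv.refl_apply, Equiv.refl_apply, h1 t, forall_transport χ₁ hb' he (P := fun m => m = 1) h2 t]
  /- 6. the two coverings -/
  obtain ⟨S₂, hfin₂, hV₂, hE₂⟩ := exists_cover χ₂ hglue₂
  obtain ⟨S₁, hfin₁, hV₁, hE₁⟩ := exists_cover χ₁ hglue₁
  /- 7. (a) at `w` and (b) at the cusp `e` -/
  have hdom : ∀ γ : 𝒢.Gv w, (∀ s, (S₁.SV w).obj.ρ γ s = s) → ∀ s, (S₂.SV w).obj.ρ γ s = s := by
    intro γ hγ
    rw [hV₂, hχ₂w]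
    have h1 : χ₁ w γ = 1 := (hV₁ w γ).mp hγ
    have h1' : fst (χ₂ w γ) = 1 := h1
    rw [hχ₂w] at h1'
    change inl (χw₁ γ) = 1
    have : χw₁ γ = 1 := h1'
    rw [this, map_one]
  have hmove : ∃ γ : 𝒢.Ge (𝒢.graph.edgeOf be.1), (∀ s, (S₁.SE (𝒢.graph.edgeOf be.1)).obj.ρ γ s = s) ∧
      ∃ s, (S₂.SE (𝒢.graph.edgeOf be.1)).obj.ρ γ s ≠ s := by
    obtain ⟨t₀, ht₀⟩ := (hVu be).2.1
    rw [hdue] at ht₀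
    refine ⟨t₀, (hE₁ be.1 u be.2 t₀).mpr ?_, ?_⟩
    · change fst (χ₂ u (𝒢.brHom be.1 u be.2 t₀)) = 1
      rw [hχ₂u, ht₀]
      rfl
    · by_contra hcon
      have hall : ∀ s, (S₂.SE (𝒢.graph.edgeOf be.1)).obj.ρ t₀ s = s := fun s =>
        not_not.mp fun hs => hcon ⟨s, hs⟩
      have h := (hE₂ be.1 u be.2 t₀).mp hall
      rw [hχ₂u, ht₀, ofAdd_eq_one] at h
      exact neg_ne_zero.mpr (one_ne_zero : (1 : ZMod ℓ) ≠ 0) (Prod.mk_eq_zero.mp h).2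
  /- 8. assembly through the two-level criterion -/
  let T₁ : BTempCat 𝒢 := ⟨S₁, FiniteIsTempered_holds 𝒢 h36.isConnected h36.isCountable S₁ hfin₁⟩
  let T₂ : BTempCat 𝒢 := ⟨S₂, FiniteIsTempered_holds 𝒢 h36.isConnected h36.isCountable S₂ hfin₂⟩
  haveI : Finite (T₁.obj.SV w).obj.V := hfin₁.finite_V w
  haveI : Finite (T₂.obj.SV w).obj.V := hfin₂.finite_V w
  obtain ⟨U, N, hU, hN, hTN, hLU⟩ :=
    StableCurveTemperedData.exists_twoLevel_decomp_singleVertex_of_coverings h36.isQuasiCoherent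
      h36.isGaloisCountable c T₁ T₂ hdom hmove hTpH
  exact StableCurveTemperedData.not_map_le_conj_closure_of_twoLevel c hι TpH U N hU hN hTN (hLU L hL) g

end Main

end DoublyBoundCusp

end Literature.IUT.HodgeTheaters
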